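import Summits.QuantumFields.YangMills.Theorems.BalabanLadderIRRankPurityDefs
import Summits.QuantumFields.YangMills.Theorems.BalabanLadderIRLightCodePincer
import Summits.QuantumFields.YangMills.Theorems.BalabanLadderIRPinnedExit96
import Summits.QuantumFields.YangMills.Theorems.DoublingDefectRecursionToGapIteration
import HarnessLib

/-!
# Helper toward crux `BalabanLadder.IR` ∕ `IRcof` (stmt-QuantumFields-19354 ∕ 26930) — LINE D «rank-purity», part 2: THE SEAM AND THE
# COMPOSITIONS (ideator ym-ir-idea-14 gen 4; lens strengthen-to-induct applied to the residual token `N = IRnsc`)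

HONESTY.  Nothing here proves the Clay Yang–Mills mass gap, a lattice gap, `IRnsc`, `IRcof` or `BalabanLadder.IR`; `R4` closes only the
conditional finite-𝕋⁴ rung `BalabanLadder.UV`.  Sorry-free part 2 of the crux workfile `Cruxes/IR/Lines/rank_purity.lean`: the SEAM
`multipletPinned_of_exit_squaring : PinnedRankExit → RankTailSquaring → MultipletPinned` (per `(G, r, a)`: Q from PXᴷ, the basin `(C, η, β₀, S₀)`
from Rᴷ, PXᴷ at tolerance `1/(16·C')` with `C' = max C (max 2 (1/η))`; the capped infimum `δ := min (infTail) η` obeys the doubling recursion on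
`[S₀, ∞)`, the generic landed `DoublingDefect.defect_decay_of_recursion` gives `δ(S') ≤ C'⁻¹e^{−(S'+1)/S⋆}` for `S' ≥ 2S⋆`, which is read at the
canonical cold shape, propagated in the time extent and padded to `Fin Q`: `LightMultipletPressureAt r β Q (1/S⋆)` with pin `a β·S⋆ ≤ T`), and the
compositions BY NAME `irnsc_of_multipletPinned` ∕ `irnsc_of_rankPurity : PinnedRankExit → RankTailSquaring → BlindGivenMultiplet → IRnsc`
(via the landed `FluxCodeBlindness.gapInUnits_of_lightCode_pinned`) and `IR_of : PinnedExitAt (1/24) → … → Theses.BalabanLadder.IR`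
(via `PinnedExit96.IR_of`).  Bill of record (R423 ∕ №25 ∕ №27): `IRcof` = K1 ∧ X ∧ N; this pair of files bills ONLY the token N.
-/

set_option autoImplicit false

noncomputable section

open MeasureTheory Filter Topology
open scoped BigOperators SchwartzMap
open Literature.MathematicalPhysics.QuantumFieldTheory Literature.MathematicalPhysics.QuantumLattice
open Summit.QuantumFields.YangMills.Cruxes.OSLegsFromFemtoAndGap.DlrCollarTransfer (GapInUnits LowerBounds)
open Summit.QuantumFields.YangMills.Cruxes.IR.ColdPressurePincer (IRsc IRnsc)
open Summit.QuantumFields.YangMills.Cruxes.IR.FluxCodeBlindness (LightMultipletPressureAt LightCodeCertificateAt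
  gapInUnits_of_lightCode_pinned)
open Summit.QuantumFields.YangMills.Theorems.DoublingDefect (exists_ratios_hasSum_traceExcess defect_decay_of_recursion)

namespace Summit.QuantumFields.YangMills.Cruxes.IR.RankPurity

/-! ## §5 THE SEAM (PROVED): PXᴷ ∧ Rᴷ ⇒ S⁺ -/

/-- **PXᴷ ∧ Rᴷ ⇒ `MultipletPinned`.**  Per `(G, r, a)`: PXᴷ gives the rank `Q`; Rᴷ at `Q` gives `(C, β₀, S₀)`; PXᴷ at the basin
tolerance `1/(16·max C 2)` and floor `max S₀ 1` gives `(T, β₁)`.  For `β ≥ max β₀ β₁ 0` the pinned box `S⋆` has `δ_Q(S⋆) ≤ 1/(16 C')`,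
the infimum recursion holds on `[S₀, ∞)`, so `DoublingDefect.defect_decay_of_recursion` gives `δ_Q(S') ≤ C'⁻¹ e^{−(S'+1)/S⋆}` for all
`S' ≥ 2S⋆`; at each such `S'` some `≤ Q` removed levels leave tail `≤ e^{−(coldExp S' + 2)/S⋆}` at the canonical cold shape, hence
(`rankTail_le_exp_of_le`) `≤ e^{−(m+2)/S⋆}` at every cold extent, and padding gives `LightMultipletPressureAt r β Q (1/S⋆)` with
`C₀ = 1`; the pin is `a β · S⋆ ≤ a β · (2S⋆+1) ≤ T`. -/
theorem multipletPinned_of_exit_squaring (hP : PinnedRankExit) (hR : RankTailSquaring) : MultipletPinned := by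
  intro G _ _ _ _ hG hnsc
  letI : MeasurableSpace G := borel G
  haveI : BorelSpace G := ⟨rfl⟩
  intro r a ha ha0 hlb
  haveI : SecondCountableTopology G :=
    (r.continuous.isClosedEmbedding r.injective).isEmbedding.secondCountableTopology
  obtain ⟨Q, hQ⟩ := hP G hG hnsc r a ha ha0 hlb
  obtain ⟨C, η, β₀, S₀, hC, hη, hrec⟩ := hR G hG hnsc r Q
  set C' : ℝ := max C (max 2 (1 / η)) with hC'def
  have hCC' : C ≤ C' := le_max_left _ _
  have hC'2 : 2 ≤ C' := (le_max_left _ _).trans (le_max_right _ _)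
  have hC'η : 1 / η ≤ C' := (le_max_right _ _).trans (le_max_right _ _)
  have hC' : 0 < C' := lt_of_lt_of_le hC hCC'
  have hC'inv : C'⁻¹ ≤ η := by
    have h := inv_anti₀ (one_div_pos.2 hη) hC'η
    rwa [one_div, inv_inv] at h
  have hηC' : η ≤ C' * η ^ 2 := by
    -- `η = (1/η) · η² ≤ C' · η²`
    have : (1 / η) * η ^ 2 = η := by field_simp
    nlinarith [mul_le_mul_of_nonneg_right hC'η (sq_nonneg η)]
  obtain ⟨T, β₁, hpx⟩ := hQ (1 / (16 * C')) (by positivity) (max S₀ 1)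
  refine ⟨Q, T, max β₀ (max β₁ 0), fun β hβ => ?_⟩
  have hββ₀ : β₀ ≤ β := le_trans (le_max_left _ _) hβ
  have hββ₁ : β₁ ≤ β := le_trans ((le_max_left _ _).trans (le_max_right _ _)) hβ
  have hβ0 : (0 : ℝ) ≤ β := le_trans ((le_max_right _ _).trans (le_max_right _ _)) hβ
  obtain ⟨Ss, hSs, hpin, hFex⟩ := hpx β hββ₁
  have hSs0 : S₀ ≤ Ss := le_trans (le_max_left _ _) hSs
  have hSs1 : 1 ≤ Ss := le_trans (le_max_right _ _) hSs
  -- the inductive quantity at this `β`: the achievable-tail infimum, capped at the basin radius `η`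
  set δ : ℕ → ℝ := fun S => min (infTail r β Q S) η with hδ
  have hrec' : ∀ S : ℕ, S₀ ≤ S → ∀ S' : ℕ, 2 * S ≤ S' → S' ≤ 4 * S → δ S' ≤ C' * δ S ^ 2 := by
    intro S hS S' h2 h4
    by_cases hin : infTail r β Q S < η
    · -- inside the basin: Rᴷ fires
      have h := infTail_recursion (r := r) (Q := Q) (S := S) hβ0 hC.le (S' := S') hin
        (fun ι _ rr i₀ hd F hF hc hFη ι' _ rr' i₀' hd' =>
          hrec β hββ₀ S hS S' h2 h4 ι rr i₀ hd F hF hc hFη ι' rr' i₀' hd')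
      have hδS : δ S = infTail r β Q S := min_eq_left hin.le
      rw [hδS]
      exact (min_le_left _ _).trans (h.trans (mul_le_mul_of_nonneg_right hCC' (sq_nonneg _)))
    · -- outside the basin the capped quantity is `η ≤ C' η²`
      have hδS : δ S = η := min_eq_right (not_lt.1 hin)
      rw [hδS]
      exact (min_le_right _ _).trans hηC'
  have hnn : ∀ S : ℕ, S₀ ≤ S → 0 ≤ δ S := fun S _ => le_min (infTail_nonneg hβ0) hη.le
  have hex : δ Ss ≤ 1 / (16 * C') :=
    (min_le_left _ _).trans (infTail_le_of_mem hβ0 fun ι _ rr i₀ hd => hFex ι rr i₀ hd)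
  have hdec := defect_decay_of_recursion (δ := δ) hC' hrec' hnn hSs0 hSs1 hex
  have hSsR : (0 : ℝ) < Ss := by exact_mod_cast (by omega : 0 < Ss)
  refine ⟨Ss, hSs1, ?_, ?_⟩
  · -- the pin `a β · S⋆ ≤ a β · (2 S⋆ + 1) ≤ T`
    have h1 : (Ss : ℝ) ≤ ((2 * Ss + 1 : ℕ) : ℝ) := by exact_mod_cast (by omega : Ss ≤ 2 * Ss + 1)
    exact (mul_le_mul_of_nonneg_left h1 (ha β).le).trans hpin
  · -- `LightMultipletPressureAt r β Q (1 / S⋆)` with `C₀ = 1`, threshold `2 S⋆`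
    refine ⟨1, zero_le_one, 2 * Ss, fun S' hS' => ?_⟩
    -- some `≤ Q` removed levels at `S'` leave tail `≤ e^{−(S'+1)/S⋆}`
    have hδS' := hdec S' hS'
    have hpos : 0 < C'⁻¹ * Real.exp (-(((S' : ℝ) + 1) / Ss)) := mul_pos (inv_pos.2 hC') (Real.exp_pos _)
    -- the decayed cap is `< η`, so the minimum is the infimum itself
    have hexp1 : Real.exp (-(((S' : ℝ) + 1) / Ss)) < 1 :=
      Real.exp_lt_one_iff.2 (by
        have : (0 : ℝ) < ((S' : ℝ) + 1) / Ss := by positivity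
        linarith)
    have hδη : δ S' < η :=
      lt_of_le_of_lt hδS' (lt_of_lt_of_le (by nlinarith [inv_pos.2 hC']) hC'inv)
    have hinf : infTail r β Q S' < η := by
      rcases min_lt_iff.1 hδη with h | h
      · exact h
      · exact absurd h (lt_irrefl _)
    have hδeq : δ S' = infTail r β Q S' := min_eq_left hinf.le
    rw [hδeq] at hδS'
    have hlt : infTail r β Q S' < 2 * (C'⁻¹ * Real.exp (-(((S' : ℝ) + 1) / Ss))) := by linarith
    have hmem : 2 * (C'⁻¹ * Real.exp (-(((S' : ℝ) + 1) / Ss))) ∈ achievable r β Q S' :=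
      mem_achievable_of_infTail_lt hlt
    obtain ⟨ι, hdecι, rr, i₀, hd⟩ := exists_ratioDatum r hβ0 (2 * S' + 1)
    obtain ⟨F, hF, hcard, hle⟩ := hmem ι rr i₀ hd
    -- `2 C'⁻¹ e^{−(S'+1)/S⋆} ≤ e^{−(1/S⋆)(coldExp S' + 2)}`
    have h2C : 2 * C'⁻¹ ≤ 1 := by
      rw [inv_eq_one_div]
      have := one_div_le_one_div_of_le two_pos hC'2
      linarith
    have hbase : rankTail r.ρ β (2 * S' + 1) rr F (coldExp S') ≤
        Real.exp (-(1 / (Ss : ℝ) * ((coldExp S' + 2 : ℕ) : ℝ))) := by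
      refine hle.trans ?_
      rw [← mul_assoc]
      refine (mul_le_of_le_one_left (Real.exp_pos _).le h2C).trans (Real.exp_le_exp.2 ?_)
      rw [neg_le_neg_iff, one_div_mul_eq_div, div_le_div_iff_of_pos_right hSsR]
      have h : 2 * (coldExp S' + 2) ≤ S' + 4 := coldExp_add_two_le S'
      have h' : ((coldExp S' + 2 : ℕ) : ℝ) ≤ (S' : ℝ) + 1 := by
        have : coldExp S' + 2 ≤ S' + 1 := by omega
        exact_mod_cast this
      exact h'
    obtain ⟨θ, hθ, hθsum⟩ := exists_fin_pad hd.1 F hcard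
    refine ⟨θ, hθ, fun m hm => ?_⟩
    have hmk : coldExp S' ≤ m := coldExp_le hm
    have hprop := rankTail_le_exp_of_le hd hF hmk hbase
    rw [hθsum m]
    refine (le_of_eq_of_le rfl hprop).trans ?_
    have hV : (1 : ℝ) ≤ 1 * ((2 * S' + 1 : ℕ) : ℝ) ^ 3 := by
      rw [one_mul]
      exact one_le_pow₀ (by exact_mod_cast (by omega : 1 ≤ 2 * S' + 1))
    exact le_mul_of_one_le_left (Real.exp_pos _).le hV

/-! ## §6 Compositions BY NAME -/

/-- **S⁺ ∧ BLINDᴷ ⇒ `IRnsc`** (REAL proof): per non-simply-connected `(G, r, a)`, BLINDᴷ turns the pinned multiplet into the pinned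
light-code certificate, and the landed `FluxCodeBlindness.gapInUnits_of_lightCode_pinned` concludes `GapInUnits G r a`. -/
theorem irnsc_of_multipletPinned (hW : MultipletPinned) (hB : BlindGivenMultiplet) : IRnsc := by
  intro G _ _ _ _ hG hnsc
  letI : MeasurableSpace G := borel G
  haveI : BorelSpace G := ⟨rfl⟩
  intro r a ha ha0 hlb
  obtain ⟨Q, T, β₂, hWβ⟩ := hW G hG hnsc r a ha ha0 hlb
  obtain ⟨Q', wd, ξ, β₂', T', hon, hpin⟩ := hB G hG hnsc r a ha ⟨Q, T, β₂, hWβ⟩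
  exact gapInUnits_of_lightCode_pinned r a ha ha0 hon hpin

/-- **PXᴷ ∧ Rᴷ ∧ BLINDᴷ ⇒ `IRnsc`** — LINE D's bill for the residual token, PROVED modulo its three stubs. -/
theorem irnsc_of_rankPurity (hP : PinnedRankExit) (hR : RankTailSquaring) (hB : BlindGivenMultiplet) : IRnsc :=
  irnsc_of_multipletPinned (multipletPinned_of_exit_squaring hP hR) hB

/-! ## §6b The conditional composition to the crux decl (by name; no stubs in this file) -/

/-- **The composition (REAL proof): PX → PXᴷ → Rᴷ → BLINDᴷ → `BalabanLadder.IR`**, by `PinnedExit96.IR_of` (simply-connected half)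
and `irnsc_of_rankPurity` (non-simply-connected half). -/
theorem IR_of (hPX : PinnedExit96.PinnedExitAt (1 / 24)) (hP : PinnedRankExit) (hR : RankTailSquaring)
    (hB : BlindGivenMultiplet) : Summit.QuantumFields.YangMills.Theses.BalabanLadder.IR :=
  PinnedExit96.IR_of hPX (irnsc_of_rankPurity hP hR hB)

end Summit.QuantumFields.YangMills.Cruxes.IR.RankPurity

end
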